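import Mathlib
import Summits.Ventures.HodgeRepro2.T5PrincipalUnitFiltration
import Summits.Ventures.HodgeRepro2.T5DominantParameter

/-!
# The two higher unit groups are the same: divisibility in `𝒪_E` ↔ valuation on `E^×`

Dictionary (Mathlib + own prefix) between the two kernel descriptions of the higher unit groups
`U_E^n` used in the N5 [A]-ledger of route/T5-route-2.md:

* `T5PrincipalUnitFiltration.higherUnits ϖ n : Subgroup 𝒪ˣ = {u ∣ ϖ^n ∣ u − 1}` (divisibility in the
  ring of integers; (A10), rows 41–50 of route/LEAN-ANNEX-p4.md), and
* `T5DominantParameter.higherUnits v γ : Subgroup Kˣ = {x ∣ v (x − 1) ≤ γ}` (the valuation;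
  Lemma N5.L7's estimates, row 51).

For `v : Valuation K Γ₀` with integers `O` (`v.Integers O`, e.g. `O = v.integer`) and `ϖ ∈ O` with
`v ϖ ^ n < 1`: `ϖ^n ∣ u − 1` in `O` iff `v (u − 1) ≤ v ϖ ^ n` (`dvd_sub_one_iff`), so the image of
`T5PrincipalUnitFiltration.higherUnits ϖ n` in `Kˣ` IS `T5DominantParameter.higherUnits v (v ϖ ^ n)`
(`map_higherUnits_eq`; every element of the latter is a unit of `O`, `exists_unitsMap_eq`). The
DVR form (`ϖ` irreducible, `n ≥ 1`) is `map_higherUnits_eq_of_irreducible`.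

Uses an L-value-free non-vanishing device: NO (README §8(d)).
-/

namespace Summit.Ventures.HodgeRepro2.T5HigherUnitsDictionary

open Valuation

variable {K Γ₀ : Type*} [Field K] [LinearOrderedCommGroupWithZero Γ₀] (v : Valuation K Γ₀)
variable {O : Type*} [CommRing O] [Algebra O K]

/-- The units of `O` as units of `K`. -/
noncomputable def unitsMap : Oˣ →* Kˣ := Units.map (algebraMap O K : O →* K)

/-- `unitsMap x = algebraMap O K x` on the underlying elements. -/
theorem coe_unitsMap (x : Oˣ) : ((unitsMap (K := K) (O := O) x : Kˣ) : K) = algebraMap O K x := rfl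

/-- `unitsMap` is injective. -/
theorem unitsMap_injective (hv : v.Integers O) : Function.Injective (unitsMap (K := K) (O := O)) :=
  Units.map_injective hv.hom_inj

/-- Divisibility in `O` against the valuation on `K`: `ϖ^n ∣ u − 1` iff `v (u − 1) ≤ v ϖ ^ n`. -/
theorem dvd_sub_one_iff (hv : v.Integers O) (ϖ : O) (n : ℕ) (x : Oˣ) :
    ϖ ^ n ∣ (x : O) - 1 ↔ v ((unitsMap (K := K) x : K) - 1) ≤ v (algebraMap O K ϖ) ^ n := by
  rw [hv.dvd_iff_le, map_pow, v.map_pow, _root_.map_sub, map_one, coe_unitsMap]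

/-- The two membership conditions agree on the units of `O`. -/
theorem mem_higherUnits_iff_mem (hv : v.Integers O) (ϖ : O) (n : ℕ)
    (hn : v (algebraMap O K ϖ) ^ n < 1) (x : Oˣ) :
    x ∈ T5PrincipalUnitFiltration.higherUnits ϖ n ↔
      unitsMap x ∈ T5DominantParameter.higherUnits v (v (algebraMap O K ϖ) ^ n) hn := by
  rw [T5PrincipalUnitFiltration.mem_higherUnits, T5DominantParameter.mem_higherUnits_iff,
    dvd_sub_one_iff v hv]

/-- Every element of the valuation-defined `U(γ)` (`γ < 1`) is a unit of `O`. -/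
theorem exists_unitsMap_eq (hv : v.Integers O) {γ : Γ₀} (hγ : γ < 1) {y : Kˣ}
    (hy : y ∈ T5DominantParameter.higherUnits v γ hγ) : ∃ x : Oˣ, unitsMap x = y := by
  have h1 : v (y : K) = 1 := T5DominantParameter.val_eq_one_of_mem v hy
  obtain ⟨a, ha⟩ := hv.exists_of_le_one h1.le
  have hu : IsUnit a := hv.isUnit_of_one' (by rw [ha, h1])
  obtain ⟨u, rfl⟩ := hu
  exact ⟨u, Units.ext (by rw [coe_unitsMap, ha])⟩

/-- The dictionary: the image in `Kˣ` of the divisibility-defined `U^n` is the valuation-defined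
`U(v ϖ ^ n)`. -/
theorem map_higherUnits_eq (hv : v.Integers O) (ϖ : O) (n : ℕ)
    (hn : v (algebraMap O K ϖ) ^ n < 1) :
    (T5PrincipalUnitFiltration.higherUnits ϖ n).map (unitsMap (K := K)) =
      T5DominantParameter.higherUnits v (v (algebraMap O K ϖ) ^ n) hn := by
  ext y
  constructor
  · rintro ⟨x, hx, rfl⟩
    exact (mem_higherUnits_iff_mem v hv ϖ n hn x).1 hx
  · intro hy
    obtain ⟨x, rfl⟩ := exists_unitsMap_eq v hv _ hy
    exact ⟨x, (mem_higherUnits_iff_mem v hv ϖ n hn x).2 hy, rfl⟩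

/-- A uniformiser has `v ϖ ^ n < 1` for `n ≥ 1`. -/
theorem pow_lt_one_of_irreducible (hv : v.Integers O) {ϖ : O} (hϖ : Irreducible ϖ) {n : ℕ}
    (hn : n ≠ 0) :
    v (algebraMap O K ϖ) ^ n < 1 :=
  pow_lt_one₀ zero_le (hv.valuation_irreducible_lt_one hϖ) hn

/-- The dictionary in the DVR form of (A10): `ϖ` irreducible, `n ≥ 1`. -/
theorem map_higherUnits_eq_of_irreducible (hv : v.Integers O) {ϖ : O} (hϖ : Irreducible ϖ)
    {n : ℕ} (hn : n ≠ 0) :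
    (T5PrincipalUnitFiltration.higherUnits ϖ n).map (unitsMap (K := K)) =
      T5DominantParameter.higherUnits v (v (algebraMap O K ϖ) ^ n)
        (pow_lt_one_of_irreducible v hv hϖ hn) :=
  map_higherUnits_eq v hv ϖ n _

/-- The dictionary on Mathlib's own integer ring `v.integer`. -/
theorem map_higherUnits_eq_integer (ϖ : v.integer) (n : ℕ)
    (hn : v (algebraMap v.integer K ϖ) ^ n < 1) :
    (T5PrincipalUnitFiltration.higherUnits ϖ n).map (unitsMap (K := K)) =
      T5DominantParameter.higherUnits v (v (algebraMap v.integer K ϖ) ^ n) hn :=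
  map_higherUnits_eq v (Valuation.integer.integers v) ϖ n hn

end Summit.Ventures.HodgeRepro2.T5HigherUnitsDictionary
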